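import Literature.AlgebraicGeometry.HodgeTheory.SemiregularVariationalHodgeISemiregularModel
import Literature.AlgebraicGeometry.HodgeTheory.SemiregularVariationalHodgeTwistedPerfect
import Literature.AlgebraicGeometry.HodgeTheory.HomComplexSigmaSingle
import Literature.AlgebraicGeometry.Modules.StrictlyPerfectResolution
import HarnessLib

/-!
# Buchweitz–Flenner 2003, Thm. 5.1 in its PRINTED generality: an `I`-semiregular COHERENT sheaf `ℰ_0`
# (semiregularity map of the perfect complex `ℰ_0`, [BF03, Def. 4.1]), special fibre up to a model isomorphism

Family `hodge`, layer `Literature/AlgebraicGeometry/HodgeTheory`. NAMED FACT (D-0014), grade **REFEREED** (Compositio Math.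
137 (2003) 135–210, Thm. 5.1). Typed by the LT-H1 literature seat `hodge-lit-semireg-typer` (cell `pub-hsemireg`, tranche
«SEMIREGULARITY CONSUMERS», director-hodge ORDER (3): «TYPE BF03 Thm 5.1 in COHERENT generality»; definition request
`DEFREQ-CoherentISemiregular-typer-g2.md`), on the real carrier `HomComplex.IsISemiregularC` (the semiregularity map
`σ_q = Tr(∗ · At(K•)^q)` of a strictly perfect complex `K•`, `HomComplexSigma.lean`, promoted into Literature for this purpose).

## Why a fourth rendering of Thm. 5.1 (the one binder that differs)

The tree's three renderings `BuchweitzFlenner2003_variationalHodge_semiregular` (`I = {1,2}`),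
`…_ISemiregular` (finite `I`, fixed fibre) and `…_ISemiregular_model` (finite `I`, model isomorphism `e : X₀ ≅ 𝒳_{s₀}`) bind the
seed as `(E₀ : X₀.left.Modules) (hE₀ : IsFiniteLocallyFree E₀)` with `IsISemiregular hE₀ {q | q + 1 ∈ I}`: a VECTOR BUNDLE —
their module docstrings say so («`ℰ_0` finite locally free — the printed coherent generality is NOT rendered»). That
restriction sits in the carrier, not in a binder: the module-level `sigmaHigher hE q` is the local-frame trace through
`E^∨∨ ⊗ Ω^q` (`SemiregularityHigherSigma.lean`), which is NOT [BF03, Def. 4.1]'s `σ` for a torsion sheaf (`E^∨ = 0` there).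
The print (p. 174 L40 – p. 175 L4, below) has `ℰ_0` an `I`-semiregular COHERENT sheaf, `σ` being defined for every perfect
complex — «every `𝒪_X`-module on a manifold when considered as a complex concentrated in degree 0 is perfect» (p. 165 L1–6 =
arXiv p. 20 L5–8). This file renders that generality: `ℰ_0` is an `𝒪_{X₀}`-module GIVEN WITH a strictly perfect resolution
`R : Modules.StrictlyPerfectResolution E₀` (a bounded complex `R.P` of finite locally free modules in degrees `≤ 0` with a
quasi-isomorphism `R.P ⟶ ℰ_0[0]`; on a smooth projective `X₀` every coherent sheaf has one, Hartshorne III Ex. 6.8–6.9, and a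
module with one is coherent), its `I`-semiregularity is the joint injectivity of `(σ_q)_{q+1 ∈ I}` on
`Ext²(ℰ_0, ℰ_0) = Hom_{D(X₀)}(R.P, R.P[2])` (`HomComplex.IsISemiregularC X₀ R.P a 0 _ {q | q + 1 ∈ I}` for some window
`[a, 0]` containing `R.P`; independent of the window and of the resolution on paper and by `HomComplexSigmaQuasiIso.lean`'s
`isISemiregularC_iff_of_roof` for resolutions dominated by a common one), and its Chern character is `KTheory`'s
`chPerfect C X₀ R.P` (= `ch_p(χ(R.P)) = ch_p(ℰ_0)`, invariant under quasi-isomorphism: `chPerfect_eq_of_quasiIso`).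
Everything else — algebraic smooth projective family `π : 𝒳 ⟶ S` of relative dimension `n` over a smooth `ℂ`-scheme
(«deformation of a compact complex algebraic manifold over a smooth germ»), cohomologically locally trivial `U ∋ s₀`, model
`e : X₀ ≅ 𝒳_{s₀}`, Chern character theory `C : ChernCharacterBetti`, flat transports of type `(p,p)` («horizontal section»),
conclusion on an open `W ∋ s₀` («for all `s` near `0`») — is VERBATIM the binder telescope of `…_ISemiregular_model`.

## Source, verbatim (Compositio Math. 137 (2003) = printed pages, as in the sibling renderings; arXiv:math/9912245 = held
## `paper:arxiv-math_9912245`, page/line locators re-read for this file)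

* «… if the class `α(0)` is the `p`th component `ch_p(ℰ_0)` of the Chern character of some coherent sheaf `ℰ_0` for which
  the `p`th component of the semiregularity map, `Ext²_{X_0}(ℰ_0, ℰ_0) → H^{p+1}(X_0, Ω^{p−1}_{X_0})`, is injective. We will
  then call `ℰ_0` in brief a `p`-semiregular sheaf. Slightly more generally, with `n` the dimension of `X_0` it is convenient to
  introduce for any subset `I ⊆ {0, …, n}` the following notion: `ℰ_0` is called `I`-semiregular if the part of the
  semiregularity map `σ_I : Ext²_{X_0}(ℰ_0, ℰ_0) → ∏_{p ∈ I} H^{p+1}(X_0, Ω^{p−1}_{X_0})` is injective.» [arXiv p. 25 L40–62 =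
  printed p. 174 L40–55]
* «**Theorem 5.1.** Let `π : X → S` be a deformation of a compact complex algebraic manifold `X_0` over a smooth germ
  `S = (S, 0)` and set `X_s := π⁻¹(s)` for `s ∈ S`. Assume that `(α_p)_{p ∈ I}` is a horizontal section in
  `∏_{p ∈ I} R^p π_*(Ω^p_{X/S})`. If there is an `I`-semiregular sheaf `ℰ_0` on `X_0` with `α_p(0) = ch_p(ℰ_0) ∈
  H^p(X_0, Ω^p_{X_0})`, `p ∈ I`, then `α_p(s) ∈ H^p(X_s, Ω^p_{X_s})` is algebraic for all `s ∈ S` near `0` and each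
  `p ∈ I`.» [arXiv p. 25 L65–80 = printed p. 174 L56 – p. 175 L4]
* [BF03, Def. 4.1] (arXiv p. 20 L47–57): «Let `X → Y` be a morphism of complex spaces and let `ℱ` be a perfect complex of
  `𝒪_X`-modules. The map `σ := Tr(∗ · exp(−At(ℱ))) : Ext²_X(ℱ, ℱ) → ∏_k H^{k+2}(X, Λ^k 𝕃_{X/Y})` is called the
  semiregularity map for `ℱ`.» The carrier omits the scalars `(−1)^k/k!` (automorphisms of the targets; injectivity unchanged).

## Faithfulness sheet (per declaration)

* `BuchweitzFlenner2003_variationalHodge_ISemiregular_coherent` — FAITHFUL to Thm. 5.1 as printed, modulo the two standing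
  renderings shared with all tree versions of Thm. 5.1: (a) smooth GERM `(S, 0)` ↦ smooth `ℂ`-scheme base, conclusion on an
  open neighbourhood `W` of `s₀` inside a cohomologically locally trivial `U`; (b) «compact complex algebraic manifold» ↦ fibre of a
  smooth projective family. `ℰ_0` coherent ↦ `ℰ_0` with a strictly perfect resolution (equivalent on smooth projective `X₀`).
  The window `a` and the resolution `R` are ∃/∀-bound data the printed `σ_I` does not depend on. NOT STRONGER than print.
* `BuchweitzFlenner2003_variationalHodge_ISemiregular_model_of_coherent` — PROVED: the vector-bundle rendering
  `…_ISemiregular_model` is the case `R := ofFiniteLocallyFree hE₀` (`R.P = ℰ_0[0]`), by the PROVED agreement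
  `HomComplex.isISemiregularC_single₀_iff` («`σ_q^C` of `ℰ_0[0]` is the module-level `σ_q`») and `chPerfect_single`.
* `BuchweitzFlenner2003_variationalHodge_ISemiregular_coherent.chPerfect_mem_algebraicClasses` — PROVED consumer shape, one degree.
Nothing here asserts HC ∕ HC_AV ∕ the Hodge conjecture for any class; no declaration of the tree discharges the fact.

## References

* [BuchweitzFlenner2003] R.-O. Buchweitz, H. Flenner, *A semiregularity map for modules and applications to deformations*,
  Compositio Math. 137 (2003) 135–210 (arXiv:math/9912245): Def. 4.1, §5 (I-semiregular) and Thm. 5.1, §6 Example 6.2, 7.18.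
* [Hartshorne1977] R. Hartshorne, *Algebraic Geometry*, III Ex. 6.8–6.9 (finite locally free resolutions on regular schemes).
-/

noncomputable section

open CategoryTheory AlgebraicGeometry
open _root_.Topology _root_.Filter
open Literature.AlgebraicTopology.SingularHomology
open Literature.AlgebraicGeometry.Modules Literature.AlgebraicGeometry.KTheory

namespace Literature.AlgebraicGeometry.HodgeTheory

/-- **Buchweitz–Flenner 2003, Thm. 5.1 — printed generality: `ℰ_0` an `I`-semiregular COHERENT sheaf.** Printed
(p. 174–175 = arXiv p. 25 L65–80): «Let `π : X → S` be a deformation of a compact complex algebraic manifold `X_0` over a smooth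
germ `S = (S, 0)` […]. Assume that `(α_p)_{p ∈ I}` is a horizontal section in `∏_{p ∈ I} R^p π_*(Ω^p_{X/S})`. If there is an
`I`-semiregular sheaf `ℰ_0` on `X_0` with `α_p(0) = ch_p(ℰ_0)`, `p ∈ I`, then `α_p(s) ∈ H^p(X_s, Ω^p_{X_s})` is algebraic for all
`s ∈ S` near `0` and each `p ∈ I`», where (p. 174 L40–55 = arXiv p. 25 L40–62) «[`ch_p(ℰ_0)` … of] some coherent sheaf `ℰ_0`
[…] `ℰ_0` is called `I`-semiregular if the part of the semiregularity map
`σ_I : Ext²_{X_0}(ℰ_0, ℰ_0) → ∏_{p ∈ I} H^{p+1}(X_0, Ω^{p−1}_{X_0})` is injective», `σ` being the semiregularity map of the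
PERFECT COMPLEX `ℰ_0` [Def. 4.1; p. 165 L1–6: «every `𝒪_X`-module on a manifold when considered as a complex concentrated in
degree 0 is perfect»]. Rendering (module docstring): for every Chern character theory `C`, smooth projective
family `π : 𝒳 ⟶ S` of relative dimension `n` over a smooth `ℂ`-scheme, cohomologically locally trivial `U ⊆ S(ℂ)` with base
point `s₀`, model `e : X₀ ≅ 𝒳_{s₀}`, `𝒪_{X₀}`-module `ℰ_0` with a strictly perfect resolution `R` and finite set `I` of CHERN
degrees such that `(σ_q)_{q+1 ∈ I}` is jointly injective on `Hom_{D(X₀)}(R.P, R.P[2]) = Ext²(ℰ_0, ℰ_0)` in some window `[a, 0]`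
(`HomComplex.IsISemiregularC`, Mathlib's standard derived category): if for every `p ∈ I` the transports of
`(e⁻¹)^* ch_p(R.P)` (`chPerfect`, `= ch_p(ℰ_0)`) along all paths in `U` are of type `(p, p)`, then on some open `W`,
`s₀ ∈ W ⊆ U`, the transports of `(e⁻¹)^* ch_p(R.P)` (`p ∈ I`) along paths inside `W` are ALGEBRAIC classes of the fibres.
The vector-bundle rendering `BuchweitzFlenner2003_variationalHodge_ISemiregular_model` is the case `R.P = ℰ_0[0]`
(`BuchweitzFlenner2003_variationalHodge_ISemiregular_model_of_coherent`). Grade: REFEREED.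
[cite: BuchweitzFlenner2003, §5 Thm. 5.1 and §5 (I-semiregular); Def. 4.1; §6 Example 6.2; 7.18] -/
def BuchweitzFlenner2003_variationalHodge_ISemiregular_coherent : Prop :=
  ∀ (C : ChernCharacterBetti) ⦃𝒳 S : Motives.SchemeOver ℂ⦄ (π : 𝒳 ⟶ S) (n : ℕ),
    Motives.IsSmoothProjectiveFamily π n → _root_.AlgebraicGeometry.Smooth S.hom →
    ∀ ⦃U : Set (Motives.ComplexPoints S)⦄ (hU : IsCohomologicallyLocallyTrivialOn π U) (s₀ : U)
      (X₀ : Motives.SchemeOver ℂ) (e : X₀ ≅ Motives.fiberOver π s₀.1)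
      (E₀ : X₀.left.Modules) (R : StrictlyPerfectResolution E₀) (I : Finset ℕ),
      (∃ (a : ℤ) (_ : R.P.IsStrictlyGE a),
          letI := HasDerivedCategory.standard X₀.left.Modules
          HomComplex.IsISemiregularC X₀ R.P a 0 R.isBoundedVB.isFiniteLocallyFree {q | q + 1 ∈ I}) →
      (∀ p ∈ I, ∀ (t : U) (γ : Path.Homotopic.Quotient s₀ t),
          IsOfHodgeType n (Motives.fiberOver π t.1) (2 * p) p p
            (transportFun π (2 * p) hU γ
              (complexBetti.map e.inv (2 * p) (chPerfect C X₀ R.P R.isBoundedVB.isFiniteLocallyFree p)))) →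
      ∃ (W : Set (Motives.ComplexPoints S)) (hWo : IsOpen W) (hW₀ : s₀.1 ∈ W) (hWU : W ⊆ U),
        ∀ p ∈ I, ∀ (t : W) (γ : Path.Homotopic.Quotient (⟨s₀.1, hW₀⟩ : W) t),
          transportFun π (2 * p) (hU.mono hWU hWo) γ
              (complexBetti.map e.inv (2 * p) (chPerfect C X₀ R.P R.isBoundedVB.isFiniteLocallyFree p)) ∈
            algebraicClasses (Motives.fiberOver π t.1) p

/-- **The vector-bundle rendering is the case `R.P = ℰ_0[0]` of the coherent rendering**:
`BuchweitzFlenner2003_variationalHodge_ISemiregular_coherent ⟹ BuchweitzFlenner2003_variationalHodge_ISemiregular_model`.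
For a finite locally free `ℰ_0` take the length-`0` resolution `ofFiniteLocallyFree hE₀` (`P = ℰ_0[0]`, window `[0, 0]`):
its complex-level `I`-semiregularity is the module-level one by the PROVED agreement `HomComplex.isISemiregularC_single₀_iff`
(`σ_q^C(ℰ_0[0]) = σ_q(ℰ_0)` on `Ext²`), and `ch_p(ℰ_0[0]) = ch_p(ℰ_0)` (`chPerfect_single`).
[cite: BuchweitzFlenner2003, §5 Thm. 5.1 and §4 (p. 165 L1–6: a module in degree 0 is perfect)] -/
theorem BuchweitzFlenner2003_variationalHodge_ISemiregular_model_of_coherent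
    (h : BuchweitzFlenner2003_variationalHodge_ISemiregular_coherent) :
    BuchweitzFlenner2003_variationalHodge_ISemiregular_model := by
  intro C 𝒳 S π n hπ hS U hU s₀ X₀ e E₀ hE₀ I hsr hHodge
  letI := HasDerivedCategory.standard X₀.left.Modules
  -- the length-0 resolution `ℰ_0[0] ⟶ ℰ_0[0]`
  let R : StrictlyPerfectResolution E₀ := StrictlyPerfectResolution.ofFiniteLocallyFree hE₀
  have hK : ∀ p, Motives.IsFiniteLocallyFree ((HomComplex.single₀ X₀.left E₀).X p) :=
    R.isBoundedVB.isFiniteLocallyFree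
  -- `ch_p(ℰ_0[0]) = ch_p(ℰ_0)`
  have hch : ∀ p, chPerfect C X₀ R.P R.isBoundedVB.isFiniteLocallyFree p = C.ch X₀ E₀ p := fun p =>
    chPerfect_single C X₀ E₀ hE₀ hK p
  -- complex-level `I`-semiregularity of `ℰ_0[0]` in the window `[0, 0]`
  have hsrC : ∃ (a : ℤ) (_ : R.P.IsStrictlyGE a),
      HomComplex.IsISemiregularC X₀ R.P a 0 R.isBoundedVB.isFiniteLocallyFree {q | q + 1 ∈ I} :=
    ⟨0, inferInstanceAs ((HomComplex.single₀ X₀.left E₀).IsStrictlyGE 0),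
      (HomComplex.isISemiregularC_single₀_iff X₀ E₀ hE₀ hK {q | q + 1 ∈ I}).2 hsr⟩
  have key := h C π n hπ hS hU s₀ X₀ e E₀ R I hsrC
  simp only [hch] at key
  exact key hHodge

/-- **Consumer shape: one degree.** Under the fact, for each `p ∈ I` the transport of `(e⁻¹)^* ch_p(ℰ_0)` (`ℰ_0` an
`I`-semiregular coherent sheaf given with a strictly perfect resolution `R`, `ch_p(ℰ_0) = chPerfect C X₀ R.P _ p`) is
algebraic on every fibre over the neighbourhood `W` reached by a path in `W`. [cite: BuchweitzFlenner2003, §5 Thm. 5.1] -/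
theorem BuchweitzFlenner2003_variationalHodge_ISemiregular_coherent.chPerfect_mem_algebraicClasses
    (hBF : BuchweitzFlenner2003_variationalHodge_ISemiregular_coherent) (C : ChernCharacterBetti)
    {𝒳 S : Motives.SchemeOver ℂ} (π : 𝒳 ⟶ S) (n : ℕ) (hπ : Motives.IsSmoothProjectiveFamily π n)
    (hS : _root_.AlgebraicGeometry.Smooth S.hom) {U : Set (Motives.ComplexPoints S)}
    (hU : IsCohomologicallyLocallyTrivialOn π U) (s₀ : U) (X₀ : Motives.SchemeOver ℂ)
    (e : X₀ ≅ Motives.fiberOver π s₀.1) (E₀ : X₀.left.Modules) (R : StrictlyPerfectResolution E₀) (I : Finset ℕ)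
    (hsr : ∃ (a : ℤ) (_ : R.P.IsStrictlyGE a),
      letI := HasDerivedCategory.standard X₀.left.Modules
      HomComplex.IsISemiregularC X₀ R.P a 0 R.isBoundedVB.isFiniteLocallyFree {q | q + 1 ∈ I})
    (hHodge : ∀ p ∈ I, ∀ (t : U) (γ : Path.Homotopic.Quotient s₀ t),
      IsOfHodgeType n (Motives.fiberOver π t.1) (2 * p) p p
        (transportFun π (2 * p) hU γ
          (complexBetti.map e.inv (2 * p) (chPerfect C X₀ R.P R.isBoundedVB.isFiniteLocallyFree p))))
    {p : ℕ} (hp : p ∈ I) :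
    ∃ (W : Set (Motives.ComplexPoints S)) (hWo : IsOpen W) (hW₀ : s₀.1 ∈ W) (hWU : W ⊆ U),
      ∀ (t : W) (γ : Path.Homotopic.Quotient (⟨s₀.1, hW₀⟩ : W) t),
        transportFun π (2 * p) (hU.mono hWU hWo) γ
            (complexBetti.map e.inv (2 * p) (chPerfect C X₀ R.P R.isBoundedVB.isFiniteLocallyFree p)) ∈
          algebraicClasses (Motives.fiberOver π t.1) p := by
  obtain ⟨W, hWo, hW₀, hWU, hW⟩ := hBF C π n hπ hS hU s₀ X₀ e E₀ R I hsr hHodge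
  exact ⟨W, hWo, hW₀, hWU, fun t γ => hW p hp t γ⟩

end Literature.AlgebraicGeometry.HodgeTheory

end
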